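import Summits.RiemannHypothesis.RiemannHypothesis.Theorems.Splittings.PrimeWindowBlindnessKrein

/-!
# Removal-only exact theft by a COUNTABLE removal set reduces to the finite case (`kreinFailsSeries`)

Third module of rh-split-screw-bridge g19's K6 object (after `PrimeWindowBlindnessKreinA` §§1–3 and
`PrimeWindowBlindnessKrein` §§4–5): §6.  For a FINITE configuration `Z` and a COUNTABLE removal set `r ⊆ ℕ` of
on-line pairs (multiplicities `n_k ≥ 0`, heights `g_k > 0`) whose trace series converges to `Ψ_Z` on a window
`|t| < U` (`RemovalOnlyTheftSeries`), the `t → 0` GERM gives, with the lane's constants (`quadTerm_germ_bounds`: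
`Ψ_Z(t) ≤ (53/24)·W_Z·t²` once every atom is unresolved; `sq_sub_le_pairTrace`: `pairTrace g t ≥ (11/12)t²` for
`g t ≤ 1`; partial sums of a nonnegative series are `≤` its sum): (C1) every finite `F ⊆ r` has
`Σ_{k∈F} n_k ≤ (53/22)·W_Z`, `W_Z = Σ_i (m₁ i + m₂ i)` — the count-theft law in its simplest (removal-only, exact)
form (`removedWeight_le_of_removalOnlyTheftSeries`); (C2) with multiplicities `≥ 1` (genuine zeros) the removal set
is finite (`removalSet_finite_of_removalOnlyTheftSeries`); (C3) hence `kreinFailsFinite` applies: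
**no finite strictly off-line configuration is stolen exactly, on any window, by removing a countable set of on-line
pairs with multiplicities `≥ 1`** (`kreinFailsSeries`, closed record `RemovalOnlyTheftNoGoSeries` / `_holds`);
tightness: the on-line atom is stolen exactly as a series too (`removalOnlyTheftSeries_onLineAtom`).

NOT decided: infinite towers `Z` (theory-1 25.24, paper); real multiplicities in `(0,1)` decaying fast (would need
the analytic `KreinBridge`); clause 3 (slides, K7′).  Elementary; ζ-free and RH-free; nothing here bears on the
truth of RH.
-/

set_option linter.dupNamespace false

namespace Summit.RiemannHypothesis.RiemannHypothesis.Theorems.Splittings.PrimeWindowBlindnessKrein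

open Summit.RiemannHypothesis.RiemannHypothesis.Theorems.Splittings.ScrewLatticeTower
open Summit.RiemannHypothesis.RiemannHypothesis.Theorems.Splittings.ScrewLatticeWolff (quadTerm)
open Summit.RiemannHypothesis.RiemannHypothesis.Theorems.Splittings.SlidingGerm (pairTrace)

/-! ## 6. Countable removal sets with multiplicities `≥ 1` reduce to the finite case (the `t → 0` germ) -/

section Series

open Summit.RiemannHypothesis.RiemannHypothesis.Theorems.Splittings.SlidingGerm
  (pairTrace_nonneg sq_sub_le_pairTrace quadTerm_germ_bounds)

/-- REMOVAL-ONLY EXACT THEFT by a COUNTABLE removal set `r ⊆ ℕ` (multiplicities `n_k ≥ 0`, heights `g_k > 0`),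
as a convergent series: `Σ_{k ∈ r} n_k · pairTrace g_k t = Ψ_Z(t)` (`HasSum`) for every `|t| < U`. -/
def RemovalOnlyTheftSeries (U : ℝ) (Z : Config) (r : Set ℕ) (n g : ℕ → ℝ) : Prop :=
  (∀ k ∈ r, 0 ≤ n k) ∧ (∀ k ∈ r, 0 < g k) ∧
    ∀ t : ℝ, |t| < U → HasSum (fun k ↦ r.indicator (fun k ↦ n k * pairTrace (g k) t) k) (Z.psi t)

/-- Weights `≥ 0` and every positive-weight atom has `κ ≠ 0` (so the germ bounds apply); implied by
`StrictOffLine`. -/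
structure GermAdmissible (Z : Config) : Prop where
  m_nonneg : ∀ i, 0 ≤ Z.m₁ i ∧ 0 ≤ Z.m₂ i
  ne₁ : ∀ i, 0 < Z.m₁ i → Z.κ₁ i ≠ 0
  ne₂ : ∀ i, 0 < Z.m₂ i → Z.κ₂ i ≠ 0

/-- A strictly off-line configuration is germ-admissible (`Re κ > 0 ⇒ κ ≠ 0`). -/
theorem StrictOffLine.germAdmissible {Z : Config} (hZ : StrictOffLine Z) : GermAdmissible Z where
  m_nonneg := hZ.m_nonneg
  ne₁ := fun i hi h0 ↦ by have := (hZ.off₁ i hi).1; rw [h0, Complex.zero_re] at this; exact lt_irrefl _ this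
  ne₂ := fun i hi h0 ↦ by have := (hZ.off₂ i hi).1; rw [h0, Complex.zero_re] at this; exact lt_irrefl _ this

/-- The total weight `W_Z = Σ_i (m₁ i + m₂ i)` of a finite configuration (both families). -/
noncomputable def totalWeight (Z : Config) [Fintype Z.ι] : ℝ := ∑ i, (Z.m₁ i + Z.m₂ i)

/-- GERM UPPER BOUND for a finite configuration: `Ψ_Z(t) ≤ (53/24)·W_Z·t²` for `|t| ≤ t₀ := 1/(1 + Σ_i (‖κ₁ i‖ + ‖κ₂ i‖))`
(every atom unresolved; `quadTerm_germ_bounds`). -/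
theorem psi_le_germ (Z : Config) [Fintype Z.ι] (hZ : GermAdmissible Z) {t : ℝ}
    (ht : |t| * (1 + ∑ i, (‖Z.κ₁ i‖ + ‖Z.κ₂ i‖)) ≤ 1) :
    Z.psi t ≤ 53 / 24 * totalWeight Z * t ^ 2 := by
  have hS : 0 ≤ ∑ i, (‖Z.κ₁ i‖ + ‖Z.κ₂ i‖) := Finset.sum_nonneg fun i _ ↦ by positivity
  have atom : ∀ (m : ℝ) (κ : ℂ), 0 ≤ m → (0 < m → κ ≠ 0) → ‖κ‖ ≤ ∑ i, (‖Z.κ₁ i‖ + ‖Z.κ₂ i‖) →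
      quadTerm m κ t ≤ 53 / 24 * m * t ^ 2 := by
    intro m κ hm hne hle
    rcases hm.eq_or_lt with h0 | hpos
    · rw [← h0]; simp [quadTerm]
    · have hκ := hne hpos
      have h1 : ‖κ‖ * |t| ≤ 1 := by
        calc ‖κ‖ * |t| ≤ (1 + ∑ i, (‖Z.κ₁ i‖ + ‖Z.κ₂ i‖)) * |t| := by
              gcongr; linarith
          _ ≤ 1 := by rwa [mul_comm]
      exact (quadTerm_germ_bounds hpos.le hκ h1).2
  have hle₁ : ∀ i, ‖Z.κ₁ i‖ ≤ ∑ j, (‖Z.κ₁ j‖ + ‖Z.κ₂ j‖) := fun i ↦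
    (le_add_of_nonneg_right (norm_nonneg _)).trans
      (Finset.single_le_sum (f := fun j ↦ ‖Z.κ₁ j‖ + ‖Z.κ₂ j‖) (fun j _ ↦ by positivity)
        (Finset.mem_univ i))
  have hle₂ : ∀ i, ‖Z.κ₂ i‖ ≤ ∑ j, (‖Z.κ₁ j‖ + ‖Z.κ₂ j‖) := fun i ↦
    (le_add_of_nonneg_left (norm_nonneg _)).trans
      (Finset.single_le_sum (f := fun j ↦ ‖Z.κ₁ j‖ + ‖Z.κ₂ j‖) (fun j _ ↦ by positivity)
        (Finset.mem_univ i))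
  show ∑' i, (quadTerm (Z.m₁ i) (Z.κ₁ i) t + quadTerm (Z.m₂ i) (Z.κ₂ i) t) ≤ _
  rw [tsum_fintype, totalWeight, Finset.mul_sum, Finset.sum_mul]
  refine Finset.sum_le_sum fun i _ ↦ ?_
  have h₁ := atom _ _ (hZ.m_nonneg i).1 (hZ.ne₁ i) (hle₁ i)
  have h₂ := atom _ _ (hZ.m_nonneg i).2 (hZ.ne₂ i) (hle₂ i)
  nlinarith [h₁, h₂]

/-- **(C1) GERM WEIGHT BOUND — the count-theft law in its simplest (removal-only, exact) form.**  Under a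
removal-only exact theft of a FINITE configuration by a countable removal set, every finite set `F ⊆ r` of removed
pairs has total multiplicity `Σ_{k∈F} n_k ≤ (53/22)·W_Z`: at a small `t > 0` the partial sum over `F` of the
nonnegative series is `≥ (11/12)t²·Σ_F n_k` (`sq_sub_le_pairTrace`) and `≤ Ψ_Z(t) ≤ (53/24)W_Z t²`. -/
theorem removedWeight_le_of_removalOnlyTheftSeries {Z : Config} [Fintype Z.ι] (hZ : GermAdmissible Z)
    {U : ℝ} (hU : 0 < U) {r : Set ℕ} {n g : ℕ → ℝ} (hT : RemovalOnlyTheftSeries U Z r n g)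
    (F : Finset ℕ) (hF : ↑F ⊆ r) : ∑ k ∈ F, n k ≤ 53 / 22 * totalWeight Z := by
  obtain ⟨hn, hg, hsum⟩ := hT
  set S := ∑ i, (‖Z.κ₁ i‖ + ‖Z.κ₂ i‖) with hSdef
  have hS : 0 ≤ S := Finset.sum_nonneg fun i _ ↦ by positivity
  set G := ∑ k ∈ F, g k with hGdef
  have hG : 0 ≤ G := Finset.sum_nonneg fun k hk ↦ (hg k (hF hk)).le
  -- the probing point
  set t := min (U / 2) (1 / (1 + S + G)) with htdef
  have ht0 : 0 < t := lt_min (by linarith) (by positivity)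
  have htU : |t| < U := by
    rw [abs_of_pos ht0]; exact (min_le_left _ _).trans_lt (by linarith)
  have ht1 : t * (1 + S + G) ≤ 1 := by
    have : t ≤ 1 / (1 + S + G) := min_le_right _ _
    rwa [le_div_iff₀ (by positivity)] at this
  -- upper: Ψ_Z(t) ≤ (53/24) W t²
  have hup : Z.psi t ≤ 53 / 24 * totalWeight Z * t ^ 2 :=
    psi_le_germ Z hZ (by rw [abs_of_pos ht0]; nlinarith [ht0.le, hG])
  -- lower: the partial sum over F
  have hgk : ∀ k ∈ F, g k * t ≤ 1 := by
    intro k hk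
    have h1 : g k ≤ G := Finset.single_le_sum (fun j hj ↦ (hg j (hF hj)).le) hk
    nlinarith [ht0.le, h1, hS, (hg k (hF hk)).le]
  have hlow : ∀ k ∈ F, 11 / 12 * t ^ 2 ≤ pairTrace (g k) t := by
    intro k hk
    have hgpos := hg k (hF hk)
    have h := sq_sub_le_pairTrace hgpos.ne' t
    have h2 : (g k * t) ^ 2 ≤ 1 := by
      have := hgk k hk
      have h0 : 0 ≤ g k * t := by positivity
      nlinarith
    nlinarith [h, h2, sq_nonneg t]
  have hpart : ∑ k ∈ F, n k * pairTrace (g k) t ≤ Z.psi t := by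
    have hind : ∀ k ∈ F, r.indicator (fun k ↦ n k * pairTrace (g k) t) k = n k * pairTrace (g k) t :=
      fun k hk ↦ Set.indicator_of_mem (hF hk) _
    calc ∑ k ∈ F, n k * pairTrace (g k) t = ∑ k ∈ F, r.indicator (fun k ↦ n k * pairTrace (g k) t) k :=
          Finset.sum_congr rfl fun k hk ↦ (hind k hk).symm
      _ ≤ Z.psi t := by
          refine sum_le_hasSum F (fun k _ ↦ ?_) (hsum t htU)
          by_cases hk : k ∈ r
          · rw [Set.indicator_of_mem hk]; exact mul_nonneg (hn k hk) (pairTrace_nonneg _ _)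
          · rw [Set.indicator_of_notMem hk]
  have hlow' : 11 / 12 * t ^ 2 * ∑ k ∈ F, n k ≤ ∑ k ∈ F, n k * pairTrace (g k) t := by
    rw [Finset.mul_sum]
    exact Finset.sum_le_sum fun k hk ↦ by
      have := mul_le_mul_of_nonneg_left (hlow k hk) (hn k (hF hk))
      linarith [this]
  have key : 11 / 12 * t ^ 2 * ∑ k ∈ F, n k ≤ 53 / 24 * totalWeight Z * t ^ 2 := hlow'.trans (hpart.trans hup)
  have ht2 : 0 < t ^ 2 := by positivity
  by_contra hcon
  have hcon' : 53 / 22 * totalWeight Z < ∑ k ∈ F, n k := not_le.mp hcon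
  nlinarith [key, ht2, mul_lt_mul_of_pos_left hcon' ht2]

/-- **(C2) multiplicities `≥ 1` ⇒ the removal set is FINITE** (`#F ≤ Σ_F n_k ≤ (53/22)W_Z` for every finite
`F ⊆ r`). -/
theorem removalSet_finite_of_removalOnlyTheftSeries {Z : Config} [Fintype Z.ι] (hZ : GermAdmissible Z)
    {U : ℝ} (hU : 0 < U) {r : Set ℕ} {n g : ℕ → ℝ} (hn1 : ∀ k ∈ r, 1 ≤ n k)
    (hT : RemovalOnlyTheftSeries U Z r n g) : r.Finite := by
  by_contra hinf
  obtain ⟨F, hF, hcard⟩ := Set.Infinite.exists_subset_card_eq hinf (⌊53 / 22 * totalWeight Z⌋₊ + 1)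
  have hW := removedWeight_le_of_removalOnlyTheftSeries hZ hU hT F hF
  have hcnt : (F.card : ℝ) ≤ ∑ k ∈ F, n k := by
    rw [Finset.card_eq_sum_ones, Nat.cast_sum]
    exact Finset.sum_le_sum fun k hk ↦ by simpa using hn1 k (hF hk)
  have hfl := Nat.lt_floor_add_one (53 / 22 * totalWeight Z)
  rw [hcard] at hcnt
  push_cast at hcnt
  linarith

/-- **(C3) `kreinFailsSeries` — REMOVAL-ONLY EXACT THEFT BY A COUNTABLE REMOVAL SET: NO**, for every finite
strictly off-line configuration, removal multiplicities `≥ 1` (genuine zeros), every window: by (C2) the removal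
set is finite, the series is a finite sum, and `kreinFailsFinite` applies. -/
theorem kreinFailsSeries {Z : Config} [Fintype Z.ι] (hZ : StrictOffLine Z) {U : ℝ} (hU : 0 < U)
    (r : Set ℕ) (n g : ℕ → ℝ) (hn1 : ∀ k ∈ r, 1 ≤ n k) : ¬ RemovalOnlyTheftSeries U Z r n g := by
  intro hT
  have hfin := removalSet_finite_of_removalOnlyTheftSeries hZ.germAdmissible hU hn1 hT
  obtain ⟨hn, hg, hsum⟩ := hT
  set r' := hfin.toFinset with hr'
  have hmem : ∀ k, k ∈ r' ↔ k ∈ r := fun k ↦ Set.Finite.mem_toFinset hfin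
  refine kreinFailsFinite hZ hU r' n g ⟨fun k hk ↦ hn k ((hmem k).1 hk), fun k hk ↦ hg k ((hmem k).1 hk),
    fun t ht ↦ ?_⟩
  have hfs : HasSum (fun k ↦ r.indicator (fun k ↦ n k * pairTrace (g k) t) k)
      (∑ k ∈ r', r.indicator (fun k ↦ n k * pairTrace (g k) t) k) :=
    hasSum_sum_of_ne_finset_zero fun k hk ↦ Set.indicator_of_notMem (fun h ↦ hk ((hmem k).2 h)) _
  rw [(hsum t ht).unique hfs]
  exact Finset.sum_congr rfl fun k hk ↦ Set.indicator_of_mem ((hmem k).1 hk) _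

/-- (C3, record sentence in the vocabulary of #812) Q_C clause 1 «REMOVAL-ONLY: NO» for FINITE configurations
and COUNTABLE removal sets of genuine zeros (multiplicities `≥ 1`), as a closed `Prop`. -/
def RemovalOnlyTheftNoGoSeries : Prop :=
  ∀ (Z : Config), Finite Z.ι → StrictOffLine Z → ∀ U : ℝ, 0 < U →
    ∀ (r : Set ℕ) (n g : ℕ → ℝ), (∀ k ∈ r, 1 ≤ n k) → ¬ RemovalOnlyTheftSeries U Z r n g

/-- (C3) holds in the kernel. -/
theorem removalOnlyTheftNoGoSeries_holds : RemovalOnlyTheftNoGoSeries := by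
  intro Z hfin hZ U hU r n g hn1
  haveI := Fintype.ofFinite Z.ι
  exact kreinFailsSeries hZ hU r n g hn1

/-- TIGHTNESS / non-vacuity of the series predicate: the on-line atom `κ = ig` (weight `m ≥ 0`) IS stolen exactly
as a series by the single removed pair `{0}` of multiplicity `2m` — so `StrictOffLine` cannot be dropped from
`kreinFailsSeries` either. -/
theorem removalOnlyTheftSeries_onLineAtom {m g : ℝ} (hm : 0 ≤ m) (hg : 0 < g) (U : ℝ) :
    RemovalOnlyTheftSeries U (onLineAtom m g) {0} (fun _ ↦ 2 * m) (fun _ ↦ g) := by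
  obtain ⟨hn, hg', hwin⟩ := removalOnlyTheft_onLineAtom hm hg U
  refine ⟨fun k _ ↦ by positivity, fun k _ ↦ hg, fun t ht ↦ ?_⟩
  have h0 : ∀ k ≠ 0, ({0} : Set ℕ).indicator (fun _ ↦ 2 * m * pairTrace g t) k = 0 :=
    fun k hk ↦ Set.indicator_of_notMem (by simpa using hk) _
  have h : HasSum (fun k ↦ ({0} : Set ℕ).indicator (fun _ ↦ 2 * m * pairTrace g t) k)
      (({0} : Set ℕ).indicator (fun _ ↦ 2 * m * pairTrace g t) 0) := hasSum_single 0 h0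
  rw [hwin t ht, Finset.sum_singleton]
  simpa using h

end Series

end Summit.RiemannHypothesis.RiemannHypothesis.Theorems.Splittings.PrimeWindowBlindnessKrein
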